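import Mathlib
import HarnessLib
import Summits.Ventures.LatticeQCDFlow.Scoring.RegenerativeCLTCoverage
import Summits.Ventures.LatticeQCDFlow.Scoring.RegenerativeCLTStudentized
import Summits.Ventures.LatticeQCDFlow.Scoring.FlowSamplerRegenerative

/-!
# The exact flow sampler on `SU(n)^E`: its regenerative (tour) estimator is ASYMPTOTICALLY NORMAL
# with the Green–Kubo variance, `√R (Â_R − π f) ⇒ N(0, e^{−2δ} σ²_f)`, and the coverage of
# `Â_R ± r/√R` converges to the Gaussian value — UNCONDITIONAL, from any start

HONEST FRAMING: exact (Metropolis-corrected) sampling algorithms for lattice gauge theory;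
figures of merit are autocorrelation/cost numbers at stated couplings and volumes; no
continuum-physics claim.

Venture `LatticeQCDFlow` (cell pub-lqcd), topic `Scoring`; FANOUT row 8 (`s0-cpn-nemc`, GEN-18).
NEW WORK of the cell, not a published result; no definition is introduced.  The `SU(n)^E` instance
of the regenerative central limit theorem (`Scoring/RegenerativeCLT.lean`,
`Scoring/RegenerativeCLTCoverage.lean`), composed exactly as `Scoring/FlowSamplerRegenerative.lean`
(GEN-17) with the tree's UNCONDITIONAL exact flow-MCMC theorem `Exactness.flowSampler_exact_doeblin`
(uniform defect `δ` of Lüscher's flow equation ⇒ weight `w = dπ/dq ∈ [e^{−2δ}, e^{2δ}]`, exactness of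
`K = indepMH q w` for `π = 𝒵⁻¹ e^{−S} D[U]`, Doeblin `K(U, ·) ≥ e^{−2δ} π`) and the observable
retrospective coins of `Scoring/IndepMHRetrospectiveCoinsSup.lean` (the coin-augmented flow-MCMC
step IS a split kernel of `(K, π, e^{−2δ})`).  Result: for every bounded measurable observable `f`,
from ANY initial configuration law, with `Â_R` the tour estimator of `R` tours and `σ²_f` the
Green–Kubo asymptotic variance of `f` under `K`:
`√R (Â_R − π f)` converges in distribution to `N(0, e^{−2δ} σ²_f)`, for every `r > 0`
`P̂(|√R (Â_R − π f)| ≤ r) → N(0, e^{−2δ} σ²_f)([−r, r])`, and — when `σ²_f > 0` — the STUDENTISED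
interval computed from the run alone, `Â_R ± z √V̂_R /(N̄_R √R)` (`V̂_R` the plug-in tour variance,
`N̄_R` the mean tour length; `Scoring/RegenerativeCLTStudentized.lean`), covers `π(f)` with
probability `→ N(0,1)([−z, z])`.  Printed counterpart NAMED ONLY:
Mykland–Tierney–Yu 1995 §3–4 (regenerative CLT and retrospective coins for independence chains) —
nothing is cited as a fact; no flow paper states a regenerative limit theorem.

## Content (hypotheses of `Scoring.flowSampler_regenerative`; `π = 𝒵⁻¹e^{−S}D[U]`)

* **`flowSampler_regenerative_clt`** — `∃ w` (the weight), `∃` the Doeblin bound, `∃ κ̂` a Markov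
  kernel on `SU(n)^E × Bool` equal to the coin-augmented flow-MCMC step and to the split kernel,
  such that for every initial law and every bounded measurable `f`:
  `TendstoInDistribution (fun R x̂ => √R (Â_R x̂ − π f)) atTop id P̂ (gaussianReal 0 (e^{−2δ} σ²_f))`,
  for every `r > 0` the coverage probabilities converge to the Gaussian value, and for `σ²_f > 0`,
  `z > 0`: `P̂(|√R (Â_R − π f) N̄_R / √V̂_R| ≤ z) → (gaussianReal 0 1)[−z, z]`.

NOT CLAIMED: any value of `δ`; a rate; the degenerate case `σ²_f = 0` of the studentised statement;
the cost of evaluating `w`.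
-/

noncomputable section

namespace Summit.Ventures.LatticeQCDFlow.Scoring

open MeasureTheory ProbabilityTheory Filter Finset Summit.Ventures.LatticeQCDFlow.Exactness
open Literature.MathematicalPhysics.QuantumFieldTheory
open Literature.MathematicalPhysics.QuantumFieldTheory.Luscher2010
open Summit.Ventures.LatticeQCDFlow.TrivializingMaps
open Literature.Probability.MarkovChains
open scoped ENNReal Matrix Matrix.Norms.Frobenius ContDiff Topology

variable {d L n : ℕ} [NeZero L]

/-- **THE EXACT FLOW SAMPLER'S REGENERATIVE ESTIMATOR IS ASYMPTOTICALLY NORMAL — UNCONDITIONAL,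
any start.**  See the module docstring.  (The inner instance binder `[IsProbabilityMeasure P̂]` is
`inferInstance` at every use; it is spelled out because instance search does not see through the
constant family `fun _ => P̂` of `TendstoInDistribution`.) -/
theorem flowSampler_regenerative_clt (B : SuBasis n)
    {S : AmbConfig d L n → ℝ} (hS : ContDiff ℝ ∞ S) {F : ℝ → AmbConfig d L n → ℝ}
    (hF : ContDiff ℝ ∞ fun p : ℝ × AmbConfig d L n => F p.1 p.2)
    {Φ : ℝ → GaugeConfig d L (Matrix.specialUnitaryGroup (Fin n) ℂ) →
      GaugeConfig d L (Matrix.specialUnitaryGroup (Fin n) ℂ)}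
    (hΦ : IsFlowMap (fun t W => -linkGrad B (F t) W) Φ) {c : ℝ → ℝ} {δ : ℝ} (hδ0 : 0 < δ)
    (hδ : ∀ t ∈ Set.Icc (0 : ℝ) 1, ∀ U : GaugeConfig d L (Matrix.specialUnitaryGroup (Fin n) ℂ),
      |luscherL B S t (F t) (WilsonFlow.coeConfig U) - S (WilsonFlow.coeConfig U) - c t| ≤ δ)
    (q : Measure (GaugeConfig d L (Matrix.specialUnitaryGroup (Fin n) ℂ))) [IsProbabilityMeasure q]
    (hq : q = Measure.map (Φ 1) (trivialMeasure (Matrix.specialUnitaryGroup (Fin n) ℂ) d L)) :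
    ∃ w : GaugeConfig d L (Matrix.specialUnitaryGroup (Fin n) ℂ) → ℝ, ∃ hw : Measurable w,
      ∃ hd : (∀ (U : GaugeConfig d L (Matrix.specialUnitaryGroup (Fin n) ℂ))
          {A : Set (GaugeConfig d L (Matrix.specialUnitaryGroup (Fin n) ℂ))}, MeasurableSet A →
          ENNReal.ofReal (Real.exp (-(2 * δ))) *
            boltzmannMeasure (fun U : GaugeConfig d L (Matrix.specialUnitaryGroup (Fin n) ℂ) =>
              S (WilsonFlow.coeConfig U)) A ≤ indepMH q w U A),
      (q.withDensity fun U => ENNReal.ofReal (w U)) =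
        boltzmannMeasure (fun U : GaugeConfig d L (Matrix.specialUnitaryGroup (Fin n) ℂ) =>
          S (WilsonFlow.coeConfig U)) ∧
      Kernel.Invariant (indepMH q w)
        (boltzmannMeasure fun U : GaugeConfig d L (Matrix.specialUnitaryGroup (Fin n) ℂ) =>
          S (WilsonFlow.coeConfig U)) ∧
      haveI : Fact (Measurable w) := ⟨hw⟩
      ∃ κs : Kernel (GaugeConfig d L (Matrix.specialUnitaryGroup (Fin n) ℂ) × Bool)
          (GaugeConfig d L (Matrix.specialUnitaryGroup (Fin n) ℂ) × Bool), ∃ _ : IsMarkovKernel κs,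
        -- `κ̂` IS the coin-augmented flow-MCMC step …
        (∀ p, κs p = (q.withDensity (fun V => imhAcceptE w p.1 V
            * ENNReal.ofReal (Real.exp (-(2 * δ)) * max (w p.1) (w V)))).map (fun V => (V, true))
          + ((q.withDensity (fun V => imhAcceptE w p.1 V
              * (1 - ENNReal.ofReal (Real.exp (-(2 * δ)) * max (w p.1) (w V)))))
            + (1 - imhAcceptMass q w p.1) • Measure.dirac p.1).map (fun V => (V, false))) ∧
        -- … AND a split kernel of `(K, π, e^{−2δ})` …
        (∀ p, κs p = (ENNReal.ofReal (Real.exp (-(2 * δ)))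
            • boltzmannMeasure (fun U : GaugeConfig d L (Matrix.specialUnitaryGroup (Fin n) ℂ) =>
                S (WilsonFlow.coeConfig U))).map (fun V => (V, true))
          + ((1 - ENNReal.ofReal (Real.exp (-(2 * δ)))) • @Doeblin.residualKernel _ _ (indepMH q w) _
              (boltzmannMeasure fun U : GaugeConfig d L (Matrix.specialUnitaryGroup (Fin n) ℂ) =>
                S (WilsonFlow.coeConfig U))
              (isProbabilityMeasure_boltzmannMeasure (d := d) (L := L)
                (hS.continuous.comp WilsonFlow.continuous_coeConfig))
              (ENNReal.ofReal (Real.exp (-(2 * δ))))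
              (fun U _ hA => hd U hA) p.1).map (fun V => (V, false))) ∧
        -- … so its tour estimator is asymptotically normal, from any start
        ∀ (μs : Measure (GaugeConfig d L (Matrix.specialUnitaryGroup (Fin n) ℂ) × Bool))
          [IsProbabilityMeasure μs]
          [IsProbabilityMeasure (Kernel.trajMeasure
              (X := fun _ : ℕ => GaugeConfig d L (Matrix.specialUnitaryGroup (Fin n) ℂ) × Bool) μs
              (fun j : ℕ => κs.comap (fun y : (i : ↥(Finset.Iic j)) →
                  GaugeConfig d L (Matrix.specialUnitaryGroup (Fin n) ℂ) × Bool =>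
                y ⟨j, Finset.mem_Iic.2 le_rfl⟩) (measurable_pi_apply _)))]
          (f : GaugeConfig d L (Matrix.specialUnitaryGroup (Fin n) ℂ) → ℝ), Measurable f →
          ∀ C : ℝ, (∀ U, |f U| ≤ C) →
          let π := boltzmannMeasure fun U : GaugeConfig d L (Matrix.specialUnitaryGroup (Fin n) ℂ) =>
            S (WilsonFlow.coeConfig U)
          TendstoInDistribution (fun (R : ℕ)
              (x : ℕ → GaugeConfig d L (Matrix.specialUnitaryGroup (Fin n) ℂ) × Bool) =>
              Real.sqrt R * ((∑ i ∈ Finset.range R, ∑' u, (if (∑ s ∈ Finset.range u,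
                  (if (x (s + 1)).2 then (1 : ℕ) else 0)) = i + 1 then (1 : ℝ) else 0) * f (x u).1)
                / (∑ i ∈ Finset.range R, ∑' u, (if (∑ s ∈ Finset.range u,
                  (if (x (s + 1)).2 then (1 : ℕ) else 0)) = i + 1 then (1 : ℝ) else 0))
                - ∫ V, f V ∂π))
            atTop (fun a : ℝ => a)
            (fun _ => Kernel.trajMeasure
              (X := fun _ : ℕ => GaugeConfig d L (Matrix.specialUnitaryGroup (Fin n) ℂ) × Bool) μs
              (fun j : ℕ => κs.comap (fun y : (i : ↥(Finset.Iic j)) →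
                  GaugeConfig d L (Matrix.specialUnitaryGroup (Fin n) ℂ) × Bool =>
                y ⟨j, Finset.mem_Iic.2 le_rfl⟩) (measurable_pi_apply _)))
            (gaussianReal 0 (Real.exp (-(2 * δ)) * ((∫ V, (f V - ∫ V', f V' ∂π) ^ 2 ∂π)
                + 2 * ∑' k, ∫ V, (f V - ∫ V', f V' ∂π)
                  * (kop (indepMH q w))^[k + 1] (fun V => f V - ∫ V', f V' ∂π) V ∂π)).toNNReal)
          ∧ (∀ r : ℝ, 0 < r →
            Tendsto (fun R : ℕ => (Kernel.trajMeasure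
                (X := fun _ : ℕ => GaugeConfig d L (Matrix.specialUnitaryGroup (Fin n) ℂ) × Bool) μs
                (fun j : ℕ => κs.comap (fun y : (i : ↥(Finset.Iic j)) →
                    GaugeConfig d L (Matrix.specialUnitaryGroup (Fin n) ℂ) × Bool =>
                  y ⟨j, Finset.mem_Iic.2 le_rfl⟩) (measurable_pi_apply _))).real
              {x | |Real.sqrt R * ((∑ i ∈ Finset.range R, ∑' u, (if (∑ s ∈ Finset.range u,
                    (if (x (s + 1)).2 then (1 : ℕ) else 0)) = i + 1 then (1 : ℝ) else 0) * f (x u).1)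
                  / (∑ i ∈ Finset.range R, ∑' u, (if (∑ s ∈ Finset.range u,
                    (if (x (s + 1)).2 then (1 : ℕ) else 0)) = i + 1 then (1 : ℝ) else 0))
                  - ∫ V, f V ∂π)| ≤ r})
              atTop (𝓝 ((gaussianReal 0 (Real.exp (-(2 * δ)) * ((∫ V, (f V - ∫ V', f V' ∂π) ^ 2 ∂π)
                + 2 * ∑' k, ∫ V, (f V - ∫ V', f V' ∂π)
                  * (kop (indepMH q w))^[k + 1] (fun V => f V - ∫ V', f V' ∂π) V ∂π)).toNNReal).real
                (Set.Icc (-r) r))))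
          ∧ (0 < ((∫ V, (f V - ∫ V', f V' ∂π) ^ 2 ∂π)
                + 2 * ∑' k, ∫ V, (f V - ∫ V', f V' ∂π)
                  * (kop (indepMH q w))^[k + 1] (fun V => f V - ∫ V', f V' ∂π) V ∂π) →
            ∀ z : ℝ, 0 < z →
            Tendsto (fun R : ℕ => (Kernel.trajMeasure
                (X := fun _ : ℕ => GaugeConfig d L (Matrix.specialUnitaryGroup (Fin n) ℂ) × Bool) μs
                (fun j : ℕ => κs.comap (fun y : (i : ↥(Finset.Iic j)) →
                    GaugeConfig d L (Matrix.specialUnitaryGroup (Fin n) ℂ) × Bool =>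
                  y ⟨j, Finset.mem_Iic.2 le_rfl⟩) (measurable_pi_apply _))).real
              {x | |Real.sqrt R * (((∑ i ∈ Finset.range R, (∑' u, (if (∑ s ∈ Finset.range u, (if (x (s + 1)).2 then (1 : ℕ) else 0)) = i + 1 then (1 : ℝ) else 0) * f (x u).1)) / (∑ i ∈ Finset.range R, (∑' u, (if (∑ s ∈ Finset.range u, (if (x (s + 1)).2 then (1 : ℕ) else 0)) = i + 1 then (1 : ℝ) else 0)))) - ∫ V, f V ∂π) * ((∑ i ∈ Finset.range R, (∑' u, (if (∑ s ∈ Finset.range u, (if (x (s + 1)).2 then (1 : ℕ) else 0)) = i + 1 then (1 : ℝ) else 0))) / R) / Real.sqrt ((∑ i ∈ Finset.range R, ((∑' u, (if (∑ s ∈ Finset.range u, (if (x (s + 1)).2 then (1 : ℕ) else 0)) = i + 1 then (1 : ℝ) else 0) * f (x u).1) - ((∑ i ∈ Finset.range R, (∑' u, (if (∑ s ∈ Finset.range u, (if (x (s + 1)).2 then (1 : ℕ) else 0)) = i + 1 then (1 : ℝ) else 0) * f (x u).1)) / (∑ i ∈ Finset.range R, (∑' u, (if (∑ s ∈ Finset.range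 u, (if (x (s + 1)).2 then (1 : ℕ) else 0)) = i + 1 then (1 : ℝ) else 0)))) * (∑' u, (if (∑ s ∈ Finset.range u, (if (x (s + 1)).2 then (1 : ℕ) else 0)) = i + 1 then (1 : ℝ) else 0))) ^ 2) / R)| ≤ z})
              atTop (𝓝 ((gaussianReal 0 1).real (Set.Icc (-z) z)))) := by
  obtain ⟨w, hw, hwlo, hwhi, hπ, hinv, -, hdoeb⟩ := flowSampler_exact_doeblin B hS hF hΦ hδ q hq
  haveI : Fact (Measurable w) := ⟨hw⟩
  have hS'c : Continuous fun U : GaugeConfig d L (Matrix.specialUnitaryGroup (Fin n) ℂ) =>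
      S (WilsonFlow.coeConfig U) := hS.continuous.comp WilsonFlow.continuous_coeConfig
  haveI := isProbabilityMeasure_boltzmannMeasure (d := d) (L := L) hS'c
  have he0 : 0 < Real.exp (-(2 * δ)) := Real.exp_pos _
  have he1 : Real.exp (-(2 * δ)) < 1 := Real.exp_lt_one_iff.2 (by linarith)
  have hε0 : 0 < ENNReal.ofReal (Real.exp (-(2 * δ))) := ENNReal.ofReal_pos.2 he0
  have hε1 : ENNReal.ofReal (Real.exp (-(2 * δ))) < 1 := by rw [ENNReal.ofReal_lt_one]; exact he1
  have hr : (ENNReal.ofReal (Real.exp (-(2 * δ)))).toReal = Real.exp (-(2 * δ)) :=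
    ENNReal.toReal_ofReal he0.le
  have hw0 : ∀ U, 0 < w U := fun U => he0.trans_le (hwlo U)
  have hew : ∀ U, Real.exp (-(2 * δ)) * w U ≤ 1 := fun U => by
    calc Real.exp (-(2 * δ)) * w U ≤ Real.exp (-(2 * δ)) * Real.exp (2 * δ) :=
          mul_le_mul_of_nonneg_left (hwhi U) he0.le
      _ = 1 := by rw [← Real.exp_add, neg_add_cancel, Real.exp_zero]
  refine ⟨w, hw, fun U _ hA => hdoeb U hA, hπ, hinv, ?_⟩
  obtain ⟨κs, hκsM, hretro, hsplit⟩ := exists_indepMH_retroSupKernel (q := q) hw hw0 hπ he0 he1 hew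
    (fun U _ hA => hdoeb U hA)
  refine ⟨κs, hκsM, hretro, hsplit, fun μs _ _ f hf C hC => ⟨?_, fun r hr0 => ?_, fun hσ z hz => ?_⟩⟩
  · -- the CLT, with the identity of `ℝ` under the Gaussian law as the limit variable
    have hY : HasLaw (fun a : ℝ => a)
        (gaussianReal 0 ((ENNReal.ofReal (Real.exp (-(2 * δ)))).toReal
          * ((∫ V, (f V - ∫ V', f V' ∂(boltzmannMeasure fun U :
              GaugeConfig d L (Matrix.specialUnitaryGroup (Fin n) ℂ) => S (WilsonFlow.coeConfig U))) ^ 2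
              ∂(boltzmannMeasure fun U : GaugeConfig d L (Matrix.specialUnitaryGroup (Fin n) ℂ) =>
                S (WilsonFlow.coeConfig U)))
            + 2 * ∑' k, ∫ V, (f V - ∫ V', f V' ∂(boltzmannMeasure fun U :
              GaugeConfig d L (Matrix.specialUnitaryGroup (Fin n) ℂ) => S (WilsonFlow.coeConfig U)))
              * (kop (indepMH q w))^[k + 1] (fun V => f V - ∫ V', f V' ∂(boltzmannMeasure fun U :
                GaugeConfig d L (Matrix.specialUnitaryGroup (Fin n) ℂ) => S (WilsonFlow.coeConfig U))) V
              ∂(boltzmannMeasure fun U : GaugeConfig d L (Matrix.specialUnitaryGroup (Fin n) ℂ) =>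
                S (WilsonFlow.coeConfig U)))).toNNReal)
        (gaussianReal 0 (Real.exp (-(2 * δ))
          * ((∫ V, (f V - ∫ V', f V' ∂(boltzmannMeasure fun U :
              GaugeConfig d L (Matrix.specialUnitaryGroup (Fin n) ℂ) => S (WilsonFlow.coeConfig U))) ^ 2
              ∂(boltzmannMeasure fun U : GaugeConfig d L (Matrix.specialUnitaryGroup (Fin n) ℂ) =>
                S (WilsonFlow.coeConfig U)))
            + 2 * ∑' k, ∫ V, (f V - ∫ V', f V' ∂(boltzmannMeasure fun U :
              GaugeConfig d L (Matrix.specialUnitaryGroup (Fin n) ℂ) => S (WilsonFlow.coeConfig U)))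
              * (kop (indepMH q w))^[k + 1] (fun V => f V - ∫ V', f V' ∂(boltzmannMeasure fun U :
                GaugeConfig d L (Matrix.specialUnitaryGroup (Fin n) ℂ) => S (WilsonFlow.coeConfig U))) V
              ∂(boltzmannMeasure fun U : GaugeConfig d L (Matrix.specialUnitaryGroup (Fin n) ℂ) =>
                S (WilsonFlow.coeConfig U)))).toNNReal) :=
      ⟨aemeasurable_id', by rw [Measure.map_id', hr]⟩
    exact regenerative_estimator_clt κs μs (κ := indepMH q w)
      (ν := boltzmannMeasure fun U : GaugeConfig d L (Matrix.specialUnitaryGroup (Fin n) ℂ) =>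
        S (WilsonFlow.coeConfig U)) (hmin := fun U _ hA => hdoeb U hA) hinv hε0 hε1 hsplit hf hC hY
  · have h := regenerative_estimator_coverage κs μs (κ := indepMH q w)
      (ν := boltzmannMeasure fun U : GaugeConfig d L (Matrix.specialUnitaryGroup (Fin n) ℂ) =>
        S (WilsonFlow.coeConfig U)) (hmin := fun U _ hA => hdoeb U hA) hinv hε0 hε1 hsplit hf hC hr0
    rw [hr] at h
    exact h
  · exact regenerative_studentized_coverage κs μs (κ := indepMH q w)
      (ν := boltzmannMeasure fun U : GaugeConfig d L (Matrix.specialUnitaryGroup (Fin n) ℂ) =>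
        S (WilsonFlow.coeConfig U)) (hmin := fun U _ hA => hdoeb U hA) hinv hε0 hε1 hsplit hf hC hσ hz

end Summit.Ventures.LatticeQCDFlow.Scoring

end
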